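import Mathlib
import Summits.NavierStokesRegularity.NavierStokesRegularity.Theorems.FilamentSkeletonRssSkeletonEquilibriumLengthRegularOuter

/-!
# Radial monotonicity / outer length-regularity under a FAR-FIELD velocity bound only
(helper for the registered stub `stub_lengthRegular` of crux `FilamentSkeletonRss.SkeletonEquilibrium`,
stmt-NavierStokesRegularity-15400; weakens the hypothesis of `…LengthRegularRadial` / `…LengthRegularOuter`)

The files `…LengthRegularRadial` / `…LengthRegularOuter` assume a GLOBAL bound `‖u(τ)‖ ≤ U` on the skeleton
velocity along the filament. Near the waist the skeleton velocity is as large as the drift it balances, so the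
useful form of the a-priori input is a FAR-FIELD bound: `‖u(τ)‖ ≤ U` only where `‖Ξ(τ)‖ ≥ R₀`. This file shows
that nothing else is needed: the tangency relation `u + ½Ξ − α e₃×Ξ = w T` can be MODIFIED inside the ball
`‖Ξ‖ < R₀` (put `w := 0`, `u := −(½Ξ − α e₃×Ξ)` there — the structural theorems never use continuity of `u`, `w`)
to a globally bounded pair with `U' = max U ((½ + |α|) R₀)` (`farField_modification`), whence, for every
unit-speed proper filament with a far-field velocity bound:
* `norm_le_of_between_farField` — `{τ | ‖Ξ τ‖ ≤ 4U'}` is an interval;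
* `volume_ball_outer_le_farField` — in ANY ball `B(x, D)` the parameters with `‖Ξ τ‖ > 4U'` have measure
  `≤ 4(3 + 4|α|)·D`; `volume_ball_le_of_far_farField` — balls missing `‖y‖ ≤ 4U'` are crossed with parameter
  length `≤ 4(3 + 4|α|)·D`.
So hypothesis (i) of the census for `stub_lengthRegular` is only a far-field sup bound on the skeleton velocity
along the filament; the stub stays OPEN (no-coiling inside the ball is the residue). No summit statement is
proved; NS regularity is not touched.
-/

noncomputable section

open Set Filter Topology MeasureTheory
open Literature.Analysis.FluidPDE Literature.Analysis.FluidPDE.Tao2016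
open scoped RealInnerProductSpace InnerProductSpace

namespace Summit.NavierStokesRegularity.NavierStokesRegularity.Theorems.SkeletonEquilibrium.LengthRegular
set_option linter.dupNamespace false

/-- **Far-field modification of the tangency relation.** If `u + ½Ξ − α e₃×Ξ = w Ξ′` along the filament and
`‖u(τ)‖ ≤ U` wherever `‖Ξ(τ)‖ ≥ R₀` (`R₀ ≥ 0`), then there are `u', w'` (equal to `u, w` where `‖Ξ‖ ≥ R₀`;
`u' = −(½Ξ − α e₃×Ξ)`, `w' = 0` inside) satisfying the same relation with the GLOBAL bound
`‖u'‖ ≤ max U ((½ + |α|) R₀)`. [folklore] -/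
theorem farField_modification {Ξ u : ℝ → EuclideanSpace ℝ (Fin 3)} {w : ℝ → ℝ} {α U R₀ : ℝ}
    (heq : ∀ τ, u τ + (1 / 2 : ℝ) • Ξ τ - α • cross (EuclideanSpace.single (2 : Fin 3) (1 : ℝ)) (Ξ τ)
      = w τ • deriv Ξ τ)
    (hfar : ∀ τ, R₀ ≤ ‖Ξ τ‖ → ‖u τ‖ ≤ U) :
    ∃ (u' : ℝ → EuclideanSpace ℝ (Fin 3)) (w' : ℝ → ℝ),
      (∀ τ, u' τ + (1 / 2 : ℝ) • Ξ τ - α • cross (EuclideanSpace.single (2 : Fin 3) (1 : ℝ)) (Ξ τ)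
        = w' τ • deriv Ξ τ) ∧
      (∀ τ, ‖u' τ‖ ≤ max U ((1 / 2 + |α|) * R₀)) ∧
      (∀ τ, R₀ ≤ ‖Ξ τ‖ → u' τ = u τ ∧ w' τ = w τ) := by
  classical
  refine ⟨fun τ => if R₀ ≤ ‖Ξ τ‖ then u τ
      else -((1 / 2 : ℝ) • Ξ τ - α • cross (EuclideanSpace.single (2 : Fin 3) (1 : ℝ)) (Ξ τ)),
    fun τ => if R₀ ≤ ‖Ξ τ‖ then w τ else 0, ?_, ?_, ?_⟩
  · intro τ
    by_cases h : R₀ ≤ ‖Ξ τ‖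
    · simp only [h, if_true]; exact heq τ
    · simp only [h, if_false, zero_smul]; abel
  · intro τ
    by_cases h : R₀ ≤ ‖Ξ τ‖
    · simp only [h, if_true]; exact le_trans (hfar τ h) (le_max_left _ _)
    · simp only [h, if_false, norm_neg]
      push Not at h
      have hcr : ‖cross (EuclideanSpace.single (2 : Fin 3) (1 : ℝ)) (Ξ τ)‖ ≤ ‖Ξ τ‖ := by
        have := norm_cross_le_norm_mul_norm (EuclideanSpace.single (2 : Fin 3) (1 : ℝ)) (Ξ τ)
        have he : ‖(EuclideanSpace.single (2 : Fin 3) (1 : ℝ))‖ = 1 := by simp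
        rwa [he, one_mul] at this
      calc ‖(1 / 2 : ℝ) • Ξ τ - α • cross (EuclideanSpace.single (2 : Fin 3) (1 : ℝ)) (Ξ τ)‖
          ≤ ‖(1 / 2 : ℝ) • Ξ τ‖ + ‖α • cross (EuclideanSpace.single (2 : Fin 3) (1 : ℝ)) (Ξ τ)‖ :=
            norm_sub_le _ _
        _ = 1 / 2 * ‖Ξ τ‖ + |α| * ‖cross (EuclideanSpace.single (2 : Fin 3) (1 : ℝ)) (Ξ τ)‖ := by
            rw [norm_smul, norm_smul, Real.norm_eq_abs, Real.norm_eq_abs,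
              abs_of_pos (by norm_num : (0:ℝ) < 1 / 2)]
        _ ≤ 1 / 2 * ‖Ξ τ‖ + |α| * ‖Ξ τ‖ := by gcongr
        _ = (1 / 2 + |α|) * ‖Ξ τ‖ := by ring
        _ ≤ (1 / 2 + |α|) * R₀ := by gcongr
        _ ≤ max U ((1 / 2 + |α|) * R₀) := le_max_right _ _
  · intro τ h
    simp only [h, if_true, and_self]

/-- **The velocity ball is crossed once (far-field version).** With a far-field bound `‖u‖ ≤ U` on
`‖Ξ‖ ≥ R₀` and `U' = max U ((½+|α|)R₀)`: if `‖Ξ τ₁‖ ≤ 4U'` and `‖Ξ τ₂‖ ≤ 4U'` then `‖Ξ τ‖ ≤ 4U'` for every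
`τ` between them. [folklore] -/
theorem norm_le_of_between_farField {Ξ u : ℝ → EuclideanSpace ℝ (Fin 3)} {w : ℝ → ℝ} {α U R₀ : ℝ}
    (hΞ : Differentiable ℝ Ξ) (hT : ∀ τ, ‖deriv Ξ τ‖ = 1)
    (heq : ∀ τ, u τ + (1 / 2 : ℝ) • Ξ τ - α • cross (EuclideanSpace.single (2 : Fin 3) (1 : ℝ)) (Ξ τ)
      = w τ • deriv Ξ τ)
    (hfar : ∀ τ, R₀ ≤ ‖Ξ τ‖ → ‖u τ‖ ≤ U) {τ₁ τ τ₂ : ℝ} (h₁ : τ₁ ≤ τ) (h₂ : τ ≤ τ₂)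
    (hτ₁ : ‖Ξ τ₁‖ ≤ 4 * max U ((1 / 2 + |α|) * R₀)) (hτ₂ : ‖Ξ τ₂‖ ≤ 4 * max U ((1 / 2 + |α|) * R₀)) :
    ‖Ξ τ‖ ≤ 4 * max U ((1 / 2 + |α|) * R₀) := by
  obtain ⟨u', w', heq', hu', -⟩ := farField_modification heq hfar
  exact norm_le_of_between hΞ hT heq' hu' h₁ h₂ hτ₁ hτ₂

/-- **Outer length-regularity under a far-field velocity bound.** For a unit-speed proper filament with
`u + ½Ξ − α e₃×Ξ = w Ξ′` and `‖u(τ)‖ ≤ U` wherever `‖Ξ(τ)‖ ≥ R₀`, and ANY ball `B(x, D)`: the parameters in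
the ball with `‖Ξ τ‖ > 4U'`, `U' = max U ((½+|α|)R₀)`, have Lebesgue measure `≤ 4(3 + 4|α|)·D`. [folklore] -/
theorem volume_ball_outer_le_farField {Ξ u : ℝ → EuclideanSpace ℝ (Fin 3)} {w : ℝ → ℝ} {α U R₀ : ℝ}
    (hΞ : Differentiable ℝ Ξ) (hT : ∀ τ, ‖deriv Ξ τ‖ = 1)
    (heq : ∀ τ, u τ + (1 / 2 : ℝ) • Ξ τ - α • cross (EuclideanSpace.single (2 : Fin 3) (1 : ℝ)) (Ξ τ)
      = w τ • deriv Ξ τ)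
    (hfar : ∀ τ, R₀ ≤ ‖Ξ τ‖ → ‖u τ‖ ≤ U) (htop : Tendsto (fun τ => ‖Ξ τ‖) atTop atTop)
    (hbot : Tendsto (fun τ => ‖Ξ τ‖) atBot atTop) (x : EuclideanSpace ℝ (Fin 3)) (D : ℝ) :
    volume ({τ | ‖Ξ τ - x‖ ≤ D} ∩ {τ | 4 * max U ((1 / 2 + |α|) * R₀) < ‖Ξ τ‖})
      ≤ ENNReal.ofReal (4 * (3 + 4 * |α|) * D) := by
  obtain ⟨u', w', heq', hu', -⟩ := farField_modification heq hfar
  exact volume_ball_outer_le hΞ hT heq' hu' htop hbot x D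

/-- **Far balls under a far-field velocity bound.** Same hypotheses; a ball `B(x, D)` with
`4U' + D < ‖x‖` (`U' = max U ((½+|α|)R₀)`) is crossed with parameter length `≤ 4(3 + 4|α|)·D`. [folklore] -/
theorem volume_ball_le_of_far_farField {Ξ u : ℝ → EuclideanSpace ℝ (Fin 3)} {w : ℝ → ℝ} {α U R₀ : ℝ}
    (hΞ : Differentiable ℝ Ξ) (hT : ∀ τ, ‖deriv Ξ τ‖ = 1)
    (heq : ∀ τ, u τ + (1 / 2 : ℝ) • Ξ τ - α • cross (EuclideanSpace.single (2 : Fin 3) (1 : ℝ)) (Ξ τ)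
      = w τ • deriv Ξ τ)
    (hfar : ∀ τ, R₀ ≤ ‖Ξ τ‖ → ‖u τ‖ ≤ U) (htop : Tendsto (fun τ => ‖Ξ τ‖) atTop atTop)
    (hbot : Tendsto (fun τ => ‖Ξ τ‖) atBot atTop) {x : EuclideanSpace ℝ (Fin 3)} {D : ℝ}
    (hx : 4 * max U ((1 / 2 + |α|) * R₀) + D < ‖x‖) :
    volume {τ | ‖Ξ τ - x‖ ≤ D} ≤ ENNReal.ofReal (4 * (3 + 4 * |α|) * D) := by
  obtain ⟨u', w', heq', hu', -⟩ := farField_modification heq hfar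
  exact volume_ball_le_of_far hΞ hT heq' hu' htop hbot hx

/-- **Reduction under a far-field velocity bound.** Same hypotheses; for every ball,
`volume {τ | ‖Ξ τ − x‖ ≤ D} ≤ volume (… ∩ {‖Ξ‖ ≤ 4U'}) + 4(3 + 4|α|)·D` with `U' = max U ((½+|α|)R₀)`:
length-regularity of the filament reduces to a no-coiling bound inside the ball `‖y‖ ≤ 4U'`. [folklore] -/
theorem volume_ball_le_inner_add_farField {Ξ u : ℝ → EuclideanSpace ℝ (Fin 3)} {w : ℝ → ℝ} {α U R₀ : ℝ}
    (hΞ : Differentiable ℝ Ξ) (hT : ∀ τ, ‖deriv Ξ τ‖ = 1)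
    (heq : ∀ τ, u τ + (1 / 2 : ℝ) • Ξ τ - α • cross (EuclideanSpace.single (2 : Fin 3) (1 : ℝ)) (Ξ τ)
      = w τ • deriv Ξ τ)
    (hfar : ∀ τ, R₀ ≤ ‖Ξ τ‖ → ‖u τ‖ ≤ U) (htop : Tendsto (fun τ => ‖Ξ τ‖) atTop atTop)
    (hbot : Tendsto (fun τ => ‖Ξ τ‖) atBot atTop) (x : EuclideanSpace ℝ (Fin 3)) (D : ℝ) :
    volume {τ | ‖Ξ τ - x‖ ≤ D} ≤
      volume ({τ | ‖Ξ τ - x‖ ≤ D} ∩ {τ | ‖Ξ τ‖ ≤ 4 * max U ((1 / 2 + |α|) * R₀)})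
        + ENNReal.ofReal (4 * (3 + 4 * |α|) * D) := by
  obtain ⟨u', w', heq', hu', -⟩ := farField_modification heq hfar
  exact volume_ball_le_inner_add hΞ hT heq' hu' htop hbot x D

end Summit.NavierStokesRegularity.NavierStokesRegularity.Theorems.SkeletonEquilibrium.LengthRegular
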